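import Summits.Ventures.LatticeQCDFlow.Scaling.ReplicaExchangeBareSampler
import Summits.Ventures.LatticeQCDFlow.Scaling.ConveyorLadder
import Literature.Probability.MarkovChains.ProductChainTensorisation

/-!
HONEST FRAMING: exact (Metropolis-corrected) sampling algorithms for lattice gauge theory; figures
of merit are autocorrelation/cost numbers at stated couplings and volumes; no continuum-physics
claim.

# ReplicaExchangeStarLegs — THE STAR CONVEYOR: A COLD REPLICA OF THE STAR SAMPLER IS REFRESHED ALONG THE PATH
# `x → x∘τ_k → (x∘τ_k)^{0←v} → x^{k+1←v}` (swap with the hot replica, relabel the hot replica, swap back); THE THREE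
# LEGS COST `W_k ≤ (K/(t r²))·S_k`, `(2/(r³γ₀θ))·H` AND `r⁻²·W_k` (lean-2 GEN-19, ours)

Venture-side (OURS).  Cell `lqcd-flow` (pub-lqcd), unit `pub-lqcd-lean-2-g19`, 2026-08-25.  Chapter G, groundwork for
`Scaling/ReplicaExchangeStarFloor` (the floor matching the `K²` ceiling of `Scaling/ReplicaExchangeGraphSwapDiffusive`
for the STAR topology).  Hot/cold coordinates `x = Fin.cons a r`; the star transposition `τ_k = swap(0, k+1)`; a
two-sided RATIO bound `r·μ_0 ≤ μ_{k+1} ≤ μ_0/r` (`0 < r ≤ 1`; identical levels `r = 1`).  Abbreviations (written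
out): `W_k(f) = Σ_x π̃(x)(f(x) − f(x∘τ_k))²`, `U(f) = Σ_xΣ_v π̃(x)M_0(x_0,v)(f(x) − f(x^{0←v}))²`.

## What is proved

* §1 `cons_comp_swap_zero_succ`, `tensorFun_cons_succProd`, `prod_succ_update_mul`, `sum_state_eq_sum_cons`,
  **`sum_pair_reindex`** (the involution `(a, r) ↦ (r k, update r k a)`), `tensorFun_comp_swap_zero_succ_mul`,
  `tensorFun_comp_swap_zero_succ_ge` (`π̃(x∘τ_k) ≥ r²π̃(x)`).
* §2 **`star_leg_swap`** (`= W_k`), `hot_fiber_le`, **`star_leg_hot_le`** (`≤ (1/(r³γ₀))·U`), **`star_leg_back_le`**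
  (`≤ r⁻²·W_k`), **`star_hot_variance_le`** (`≤ (1/γ₀)·U`); `γ₀` the hot update's Poincaré constant.

NOT CLAIMED: the assembled inequality (next file); anything measured.  Literature grade (cell rule): OWN MECHANISM
(chapter C's conveyor with paths of length three), NEW TYPING; nothing cited as a fact; no new bib keys.
-/

noncomputable section

open Finset Function
open Literature.Probability.MarkovChains

namespace Summit.Ventures.LatticeQCDFlow.Scaling

variable {S : Type*} [Fintype S] [DecidableEq S] {K : ℕ} {μ : Fin (K + 1) → S → ℝ}

/-! ## §1 Hot/cold coordinates -/

omit [Fintype S] [DecidableEq S] in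
/-- **The star transposition in hot/cold coordinates:** `(cons a r) ∘ τ_k = cons (r k) (update r k a)`. [ours] -/
theorem cons_comp_swap_zero_succ [DecidableEq S] (a : S) (r : Fin K → S) (k : Fin K) :
    (Fin.cons a r : Fin (K + 1) → S) ∘ Equiv.swap (0 : Fin (K + 1)) k.succ = Fin.cons (r k) (update r k a) := by
  have hne : (0 : Fin (K + 1)) ≠ k.succ := (Fin.succ_ne_zero k).symm
  funext i
  simp only [Function.comp_apply]
  by_cases h0 : i = 0
  · subst h0; rw [Equiv.swap_apply_left, Fin.cons_succ, Fin.cons_zero]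
  · obtain ⟨j, rfl⟩ := Fin.eq_succ_of_ne_zero h0
    by_cases hj : j = k
    · subst hj; rw [Equiv.swap_apply_right, Fin.cons_zero, Fin.cons_succ, update_self]
    · rw [Equiv.swap_apply_of_ne_of_ne h0 (fun e => hj (Fin.succ_injective _ e)), Fin.cons_succ, Fin.cons_succ,
        update_of_ne hj]

omit [Fintype S] [DecidableEq S] in
/-- The product weight in hot/cold coordinates: `π̃(cons a r) = μ_0(a)·Π_j μ_{j+1}(r_j)`. [ours] -/
theorem tensorFun_cons_succProd (μ : Fin (K + 1) → S → ℝ) (a : S) (r : Fin K → S) :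
    tensorFun μ (Fin.cons a r) = μ 0 a * ∏ j : Fin K, μ j.succ (r j) := by
  unfold tensorFun
  rw [Fin.prod_univ_succ]
  simp only [Fin.cons_zero, Fin.cons_succ]

omit [Fintype S] [DecidableEq S] in
/-- Updating one cold coordinate: `(Π_j μ_{j+1}((update r k b)_j))·μ_{k+1}(r_k) = (Π_j μ_{j+1}(r_j))·μ_{k+1}(b)`. [ours] -/
theorem prod_succ_update_mul (μ : Fin (K + 1) → S → ℝ) (r : Fin K → S) (k : Fin K) (b : S) :
    (∏ j : Fin K, μ j.succ (update r k b j)) * μ k.succ (r k) = (∏ j : Fin K, μ j.succ (r j)) * μ k.succ b := by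
  have h1 : ∏ j : Fin K, μ j.succ (update r k b j) = μ k.succ b * ∏ j ∈ univ.erase k, μ j.succ (r j) := by
    rw [← Finset.mul_prod_erase univ _ (mem_univ k), update_self]
    congr 1
    exact prod_congr rfl fun j hj => by rw [update_of_ne (Finset.ne_of_mem_erase hj)]
  have h2 : ∏ j : Fin K, μ j.succ (r j) = μ k.succ (r k) * ∏ j ∈ univ.erase k, μ j.succ (r j) := by
    rw [← Finset.mul_prod_erase univ _ (mem_univ k)]
  rw [h1, h2]; ring

omit [DecidableEq S] in
/-- Summing over states in hot/cold coordinates. [folklore] -/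
theorem sum_state_eq_sum_cons (G : (Fin (K + 1) → S) → ℝ) :
    ∑ x : Fin (K + 1) → S, G x = ∑ a : S, ∑ r : Fin K → S, G (Fin.cons a r) := by
  rw [← (Fin.consEquiv fun _ : Fin (K + 1) => S).sum_comp, Fintype.sum_prod_type]
  rfl

omit [Fintype S] [DecidableEq S] in
/-- The map `(a, r) ↦ (r k, update r k a)` is an involution. [ours] -/
theorem pairSwap_involutive [DecidableEq S] (k : Fin K) :
    Function.Involutive (fun p : S × (Fin K → S) => (p.2 k, update p.2 k p.1)) := by
  intro p
  simp only [update_self, update_idem, update_eq_self]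

omit [DecidableEq S] in
/-- **Reindexing along the involution `(a, r) ↦ (r k, update r k a)`.** [ours] -/
theorem sum_pair_reindex [DecidableEq S] (k : Fin K) (G : S → (Fin K → S) → ℝ) :
    ∑ a : S, ∑ r : Fin K → S, G a r = ∑ b : S, ∑ r' : Fin K → S, G (r' k) (update r' k b) := by
  rw [← Fintype.sum_prod_type' (f := fun a r => G a r), ← Fintype.sum_prod_type' (f := fun b r' => G (r' k) (update r' k b))]
  exact (Fintype.sum_equiv (pairSwap_involutive (S := S) k).toPerm _ _ fun p => rfl).symm

omit [Fintype S] [DecidableEq S] in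
/-- **The swapped weight on the star:** `π̃(x∘τ_k)·μ_0(x_0)μ_{k+1}(x_{k+1}) = π̃(x)·μ_0(x_{k+1})μ_{k+1}(x_0)`. [ours] -/
theorem tensorFun_comp_swap_zero_succ_mul (μ : Fin (K + 1) → S → ℝ) (x : Fin (K + 1) → S) (k : Fin K) :
    tensorFun μ (x ∘ Equiv.swap (0 : Fin (K + 1)) k.succ) * (μ 0 (x 0) * μ k.succ (x k.succ))
      = tensorFun μ x * (μ 0 (x k.succ) * μ k.succ (x 0)) := by
  have hne : (0 : Fin (K + 1)) ≠ k.succ := (Fin.succ_ne_zero k).symm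
  have hks : k.succ ∈ (univ : Finset (Fin (K + 1))).erase 0 := Finset.mem_erase.mpr ⟨hne.symm, mem_univ _⟩
  unfold tensorFun
  rw [← Finset.mul_prod_erase univ (fun i => μ i ((x ∘ Equiv.swap (0 : Fin (K + 1)) k.succ) i)) (mem_univ 0),
    ← Finset.mul_prod_erase _ (fun i => μ i ((x ∘ Equiv.swap (0 : Fin (K + 1)) k.succ) i)) hks,
    ← Finset.mul_prod_erase univ (fun i => μ i (x i)) (mem_univ 0),
    ← Finset.mul_prod_erase _ (fun i => μ i (x i)) hks]
  have hrest : ∏ i ∈ (univ.erase (0 : Fin (K + 1))).erase k.succ, μ i ((x ∘ Equiv.swap (0 : Fin (K + 1)) k.succ) i)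
      = ∏ i ∈ (univ.erase (0 : Fin (K + 1))).erase k.succ, μ i (x i) := by
    refine prod_congr rfl fun i hi => ?_
    have h2 : i ≠ k.succ := Finset.ne_of_mem_erase hi
    have h1 : i ≠ 0 := Finset.ne_of_mem_erase (Finset.mem_of_mem_erase hi)
    simp only [Function.comp_apply, Equiv.swap_apply_of_ne_of_ne h1 h2]
  rw [hrest]
  simp only [Function.comp_apply, Equiv.swap_apply_left, Equiv.swap_apply_right]
  ring

omit [Fintype S] [DecidableEq S] in
/-- **Under the ratio bound a star swap keeps the fraction `r²` of the weight:** `r·μ_0 ≤ μ_{k+1}`, `r·μ_{k+1} ≤ μ_0`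
⇒ `r²·π̃(x) ≤ π̃(x∘τ_k)`. [ours] -/
theorem tensorFun_comp_swap_zero_succ_ge (hμ : ∀ k u, 0 < μ k u) {r : ℝ} (hr0 : 0 ≤ r)
    (hrc : ∀ (k : Fin K) (u : S), r * μ 0 u ≤ μ k.succ u) (hrh : ∀ (k : Fin K) (u : S), r * μ k.succ u ≤ μ 0 u)
    (x : Fin (K + 1) → S) (k : Fin K) :
    r ^ 2 * tensorFun μ x ≤ tensorFun μ (x ∘ Equiv.swap (0 : Fin (K + 1)) k.succ) := by
  have hpos : 0 < μ 0 (x 0) * μ k.succ (x k.succ) := mul_pos (hμ _ _) (hμ _ _)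
  have h := tensorFun_comp_swap_zero_succ_mul μ x k
  refine le_of_mul_le_mul_right ?_ hpos
  rw [h]
  calc r ^ 2 * tensorFun μ x * (μ 0 (x 0) * μ k.succ (x k.succ))
      = tensorFun μ x * ((r * μ k.succ (x k.succ)) * (r * μ 0 (x 0))) := by ring
    _ ≤ tensorFun μ x * (μ 0 (x k.succ) * μ k.succ (x 0)) :=
        mul_le_mul_of_nonneg_left (mul_le_mul (hrh k _) (hrc k _) (mul_nonneg hr0 (hμ _ _).le) (hμ _ _).le)
          (tensorFun_pos hμ x).le

/-! ## §2 The three legs and the hot variance -/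

section Legs

variable (hμ : ∀ k u, 0 < μ k u) (hμ1 : ∀ k, ∑ u, μ k u = 1)
include hμ hμ1

omit [DecidableEq S] hμ in
/-- **The first leg IS the swap displacement:** `Σ_xΣ_v π̃(x)μ_{k+1}(v)(f x − f(x∘τ_k))² = W_k(f)`. [ours] -/
theorem star_leg_swap (f : (Fin (K + 1) → S) → ℝ) (k : Fin K) :
    ∑ x : Fin (K + 1) → S, ∑ v, tensorFun μ x * μ k.succ v * (f x - f (x ∘ Equiv.swap (0 : Fin (K + 1)) k.succ)) ^ 2
      = ∑ x : Fin (K + 1) → S, tensorFun μ x * (f x - f (x ∘ Equiv.swap (0 : Fin (K + 1)) k.succ)) ^ 2 := by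
  refine sum_congr rfl fun x _ => ?_
  have e : ∀ v, tensorFun μ x * μ k.succ v * (f x - f (x ∘ Equiv.swap (0 : Fin (K + 1)) k.succ)) ^ 2
      = μ k.succ v * (tensorFun μ x * (f x - f (x ∘ Equiv.swap (0 : Fin (K + 1)) k.succ)) ^ 2) := fun v => by ring
  simp_rw [e]
  rw [← Finset.sum_mul, hμ1, one_mul]

omit [DecidableEq S] in
/-- The fiberwise hot Poincaré step: `Σ_bΣ_v μ_0(b)μ_{k+1}(v)(h b − h v)² ≤ (1/(rγ₀))·Σ_bΣ_v μ_0(b)M_0(b,v)(h b − h v)²`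
(`r·μ_{k+1} ≤ μ_0`, `0 < r ≤ 1`, `γ₀·Var_{μ_0} ≤ 𝓔_{μ_0}(M_0)`). [ours] -/
theorem hot_fiber_le {M0 : Matrix S S ℝ} {r γ₀ : ℝ} (hr : 0 < r) (hr1 : r ≤ 1) (hγ₀ : 0 < γ₀)
    (hrh : ∀ (k : Fin K) (u : S), r * μ k.succ u ≤ μ 0 u)
    (hgap0 : ∀ h : S → ℝ, γ₀ * lawVariance (μ 0) h ≤ dirichletForm (μ 0) M0 h) (h : S → ℝ) (k : Fin K) :
    ∑ b, ∑ v, μ 0 b * μ k.succ v * (h b - h v) ^ 2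
      ≤ 1 / (r * γ₀) * ∑ b, ∑ v, μ 0 b * M0 b v * (h b - h v) ^ 2 := by
  have e1 : ∑ b, ∑ v, μ 0 b * μ k.succ v * (h b - h v) ^ 2
      = ∑ v, μ k.succ v * ∑ b, μ 0 b * (h b - h v) ^ 2 := by
    rw [Finset.sum_comm]
    refine sum_congr rfl fun v _ => ?_
    rw [Finset.mul_sum]
    exact sum_congr rfl fun b _ => by ring
  have e2 : ∀ v, ∑ b, μ 0 b * (h b - h v) ^ 2 = lawVariance (μ 0) h + (lawMean (μ 0) h - h v) ^ 2 :=
    fun v => meanSq_eq_lawVariance_add_sq (hμ1 0) h (h v)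
  simp_rw [e1, e2, mul_add]
  rw [Finset.sum_add_distrib, ← Finset.sum_mul, hμ1, one_mul]
  have e3 : ∑ v, μ k.succ v * (lawMean (μ 0) h - h v) ^ 2 ≤ 1 / r * lawVariance (μ 0) h := by
    unfold lawVariance
    rw [Finset.mul_sum]
    refine sum_le_sum fun v _ => ?_
    have : (lawMean (μ 0) h - h v) ^ 2 = (h v - lawMean (μ 0) h) ^ 2 := by ring
    rw [this, ← mul_assoc]
    refine mul_le_mul_of_nonneg_right ?_ (sq_nonneg _)
    rw [one_div, inv_mul_eq_div, le_div_iff₀ hr, mul_comm]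
    exact hrh k v
  have e4 : lawVariance (μ 0) h ≤ 1 / γ₀ * dirichletForm (μ 0) M0 h := by
    rw [one_div, inv_mul_eq_div, le_div_iff₀ hγ₀, mul_comm]; exact hgap0 h
  have hV0 : 0 ≤ lawVariance (μ 0) h := lawVariance_nonneg (fun u => (hμ 0 u).le) h
  have hE : dirichletForm (μ 0) M0 h = (1 / 2) * ∑ b, ∑ v, μ 0 b * M0 b v * (h b - h v) ^ 2 := rfl
  calc lawVariance (μ 0) h + ∑ v, μ k.succ v * (lawMean (μ 0) h - h v) ^ 2
      ≤ lawVariance (μ 0) h + 1 / r * lawVariance (μ 0) h := by linarith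
    _ = (1 + 1 / r) * lawVariance (μ 0) h := by ring
    _ ≤ (2 / r) * lawVariance (μ 0) h := by
        refine mul_le_mul_of_nonneg_right ?_ hV0
        have h1r : 1 ≤ 1 / r := by rw [le_div_iff₀ hr]; linarith
        have e : (2 : ℝ) / r = 1 / r + 1 / r := by ring
        linarith
    _ ≤ (2 / r) * (1 / γ₀ * dirichletForm (μ 0) M0 h) := mul_le_mul_of_nonneg_left e4 (by positivity)
    _ = 1 / (r * γ₀) * ∑ b, ∑ v, μ 0 b * M0 b v * (h b - h v) ^ 2 := by rw [hE]; field_simp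

/-- **THE HOT LEG:** `Σ_xΣ_v π̃(x)μ_{k+1}(v)(f(x∘τ_k) − f((x∘τ_k)^{0←v}))² ≤ (1/(r³γ₀))·U(f)` — reindex along
`(a, r) ↦ (r k, update r k a)` (weight ratio `≤ r⁻²`), then the fiberwise hot Poincaré step. [ours] -/
theorem star_leg_hot_le {M0 : Matrix S S ℝ} {r γ₀ : ℝ} (hr : 0 < r) (hr1 : r ≤ 1) (hγ₀ : 0 < γ₀)
    (hrc : ∀ (k : Fin K) (u : S), r * μ 0 u ≤ μ k.succ u) (hrh : ∀ (k : Fin K) (u : S), r * μ k.succ u ≤ μ 0 u)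
    (hgap0 : ∀ h : S → ℝ, γ₀ * lawVariance (μ 0) h ≤ dirichletForm (μ 0) M0 h)
    (f : (Fin (K + 1) → S) → ℝ) (k : Fin K) :
    ∑ x : Fin (K + 1) → S, ∑ v, tensorFun μ x * μ k.succ v
        * (f (x ∘ Equiv.swap (0 : Fin (K + 1)) k.succ) - f (update (x ∘ Equiv.swap (0 : Fin (K + 1)) k.succ) 0 v)) ^ 2
      ≤ 1 / (r ^ 3 * γ₀) * ∑ y : Fin (K + 1) → S, ∑ v, tensorFun μ y * M0 (y 0) v * (f y - f (update y 0 v)) ^ 2 := by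
  set R : (Fin K → S) → ℝ := fun r' => ∏ j : Fin K, μ j.succ (r' j) with hR
  set F : S → (Fin K → S) → ℝ := fun b r' => f (Fin.cons b r') with hF
  have hR0 : ∀ r', 0 ≤ R r' := fun r' => prod_nonneg fun j _ => (hμ _ _).le
  have L1 : ∑ x : Fin (K + 1) → S, ∑ v, tensorFun μ x * μ k.succ v
        * (f (x ∘ Equiv.swap (0 : Fin (K + 1)) k.succ) - f (update (x ∘ Equiv.swap (0 : Fin (K + 1)) k.succ) 0 v)) ^ 2
      = ∑ b : S, ∑ r' : Fin K → S, μ 0 (r' k) * R (update r' k b)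
          * ∑ v, μ k.succ v * (F b r' - F v r') ^ 2 := by
    rw [sum_state_eq_sum_cons]
    have e : ∀ (a : S) (r : Fin K → S), (∑ v, tensorFun μ (Fin.cons a r) * μ k.succ v
        * (f ((Fin.cons a r : Fin (K + 1) → S) ∘ Equiv.swap (0 : Fin (K + 1)) k.succ)
          - f (update ((Fin.cons a r : Fin (K + 1) → S) ∘ Equiv.swap (0 : Fin (K + 1)) k.succ) 0 v)) ^ 2)
        = μ 0 a * R r * ∑ v, μ k.succ v * (F (r k) (update r k a) - F v (update r k a)) ^ 2 := by
      intro a r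
      rw [cons_comp_swap_zero_succ, tensorFun_cons_succProd, Finset.mul_sum]
      refine sum_congr rfl fun v _ => ?_
      rw [Fin.update_cons_zero]
      simp only [hF, hR]
      ring
    rw [sum_congr rfl fun a _ => sum_congr rfl fun r _ => e a r]
    rw [sum_pair_reindex k (fun a r => μ 0 a * R r * ∑ v, μ k.succ v * (F (r k) (update r k a) - F v (update r k a)) ^ 2)]
    simp only [update_self, update_idem, update_eq_self]
  have W : ∀ (b : S) (r' : Fin K → S), μ 0 (r' k) * R (update r' k b) ≤ 1 / r ^ 2 * (μ 0 b * R r') := by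
    intro b r'
    have e := prod_succ_update_mul μ r' k b
    have key : r * μ 0 (r' k) * (r * μ k.succ b) ≤ μ k.succ (r' k) * μ 0 b :=
      mul_le_mul (hrc k (r' k)) (hrh k b) (mul_nonneg hr.le (hμ _ _).le) (hμ _ _).le
    have key' : μ 0 (r' k) * μ k.succ b ≤ 1 / r ^ 2 * (μ k.succ (r' k) * μ 0 b) := by
      rw [one_div, inv_mul_eq_div, le_div_iff₀ (by positivity)]; nlinarith [key]
    refine le_of_mul_le_mul_right ?_ (hμ k.succ (r' k))
    calc μ 0 (r' k) * R (update r' k b) * μ k.succ (r' k) = μ 0 (r' k) * μ k.succ b * R r' := by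
          rw [mul_assoc, hR]; simp only; rw [e]; ring
      _ ≤ 1 / r ^ 2 * (μ k.succ (r' k) * μ 0 b) * R r' := mul_le_mul_of_nonneg_right key' (hR0 r')
      _ = 1 / r ^ 2 * (μ 0 b * R r') * μ k.succ (r' k) := by ring
  have P : ∀ r' : Fin K → S, ∑ b, ∑ v, μ 0 b * μ k.succ v * (F b r' - F v r') ^ 2
      ≤ 1 / (r * γ₀) * ∑ b, ∑ v, μ 0 b * M0 b v * (F b r' - F v r') ^ 2 :=
    fun r' => hot_fiber_le hμ hμ1 hr hr1 hγ₀ hrh hgap0 (fun b => F b r') k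
  have hin0 : ∀ (b : S) (r' : Fin K → S), 0 ≤ ∑ v, μ k.succ v * (F b r' - F v r') ^ 2 :=
    fun b r' => sum_nonneg fun v _ => mul_nonneg (hμ _ _).le (sq_nonneg _)
  rw [L1]
  calc ∑ b : S, ∑ r' : Fin K → S, μ 0 (r' k) * R (update r' k b) * ∑ v, μ k.succ v * (F b r' - F v r') ^ 2
      ≤ ∑ b : S, ∑ r' : Fin K → S, 1 / r ^ 2 * (μ 0 b * R r') * ∑ v, μ k.succ v * (F b r' - F v r') ^ 2 :=
        sum_le_sum fun b _ => sum_le_sum fun r' _ => mul_le_mul_of_nonneg_right (W b r') (hin0 b r')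
    _ = 1 / r ^ 2 * ∑ r' : Fin K → S, R r' * ∑ b, ∑ v, μ 0 b * μ k.succ v * (F b r' - F v r') ^ 2 := by
        rw [Finset.sum_comm, Finset.mul_sum]
        refine sum_congr rfl fun r' _ => ?_
        rw [Finset.mul_sum, Finset.mul_sum]
        refine sum_congr rfl fun b _ => ?_
        rw [Finset.mul_sum, Finset.mul_sum, Finset.mul_sum]
        exact sum_congr rfl fun v _ => by ring
    _ ≤ 1 / r ^ 2 * ∑ r' : Fin K → S, R r' * (1 / (r * γ₀) * ∑ b, ∑ v, μ 0 b * M0 b v * (F b r' - F v r') ^ 2) :=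
        mul_le_mul_of_nonneg_left (sum_le_sum fun r' _ => mul_le_mul_of_nonneg_left (P r') (hR0 r')) (by positivity)
    _ = 1 / (r ^ 3 * γ₀) * ∑ y : Fin (K + 1) → S, ∑ v, tensorFun μ y * M0 (y 0) v * (f y - f (update y 0 v)) ^ 2 := by
        rw [sum_state_eq_sum_cons (fun y => ∑ v, tensorFun μ y * M0 (y 0) v * (f y - f (update y 0 v)) ^ 2)]
        simp only [tensorFun_cons_succProd, Fin.cons_zero, Fin.update_cons_zero]
        rw [Finset.sum_comm]
        have e3 : 1 / (r ^ 3 * γ₀) = 1 / r ^ 2 * (1 / (r * γ₀)) := by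
          rw [one_div_mul_one_div]; ring
        have lhs : 1 / r ^ 2 * ∑ r' : Fin K → S, R r' * (1 / (r * γ₀) * ∑ b, ∑ v, μ 0 b * M0 b v * (F b r' - F v r') ^ 2)
            = ∑ r' : Fin K → S, ∑ b, ∑ v, 1 / r ^ 2 * (1 / (r * γ₀)) * (R r' * (μ 0 b * M0 b v * (F b r' - F v r') ^ 2)) := by
          rw [Finset.mul_sum]
          refine sum_congr rfl fun r' _ => ?_
          rw [Finset.mul_sum, Finset.mul_sum, Finset.mul_sum]
          refine sum_congr rfl fun b _ => ?_
          rw [Finset.mul_sum, Finset.mul_sum, Finset.mul_sum]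
          exact sum_congr rfl fun v _ => by ring
        have rhs : 1 / (r ^ 3 * γ₀) * ∑ r' : Fin K → S, ∑ b, ∑ v,
              μ 0 b * (∏ j : Fin K, μ j.succ (r' j)) * M0 b v * (f (Fin.cons b r') - f (Fin.cons v r')) ^ 2
            = ∑ r' : Fin K → S, ∑ b, ∑ v, 1 / r ^ 2 * (1 / (r * γ₀)) * (R r' * (μ 0 b * M0 b v * (F b r' - F v r') ^ 2)) := by
          rw [e3, Finset.mul_sum]
          refine sum_congr rfl fun r' _ => ?_
          rw [Finset.mul_sum]
          refine sum_congr rfl fun b _ => ?_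
          rw [Finset.mul_sum]
          exact sum_congr rfl fun v _ => by simp only [hF, hR]; ring
        rw [lhs, rhs]

/-- **THE BACK LEG:** `Σ_xΣ_v π̃(x)μ_{k+1}(v)(f((x∘τ_k)^{0←v}) − f(((x∘τ_k)^{0←v})∘τ_k))² ≤ r⁻²·W_k(f)` (note
`((x∘τ_k)^{0←v})∘τ_k = x^{k+1←v}`). [ours] -/
theorem star_leg_back_le {r : ℝ} (hr : 0 < r)
    (hrc : ∀ (k : Fin K) (u : S), r * μ 0 u ≤ μ k.succ u) (hrh : ∀ (k : Fin K) (u : S), r * μ k.succ u ≤ μ 0 u)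
    (f : (Fin (K + 1) → S) → ℝ) (k : Fin K) :
    ∑ x : Fin (K + 1) → S, ∑ v, tensorFun μ x * μ k.succ v
        * (f (update (x ∘ Equiv.swap (0 : Fin (K + 1)) k.succ) 0 v)
          - f ((update (x ∘ Equiv.swap (0 : Fin (K + 1)) k.succ) 0 v) ∘ Equiv.swap (0 : Fin (K + 1)) k.succ)) ^ 2
      ≤ 1 / r ^ 2 * ∑ y : Fin (K + 1) → S, tensorFun μ y * (f y - f (y ∘ Equiv.swap (0 : Fin (K + 1)) k.succ)) ^ 2 := by
  set R : (Fin K → S) → ℝ := fun r' => ∏ j : Fin K, μ j.succ (r' j) with hR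
  set G : S → (Fin K → S) → ℝ := fun v r' =>
    (f (Fin.cons v r') - f ((Fin.cons v r' : Fin (K + 1) → S) ∘ Equiv.swap (0 : Fin (K + 1)) k.succ)) ^ 2 with hG
  have hR0 : ∀ r', 0 ≤ R r' := fun r' => prod_nonneg fun j _ => (hμ _ _).le
  have hG0 : ∀ v r', 0 ≤ G v r' := fun v r' => sq_nonneg _
  have L1 : ∑ x : Fin (K + 1) → S, ∑ v, tensorFun μ x * μ k.succ v
        * (f (update (x ∘ Equiv.swap (0 : Fin (K + 1)) k.succ) 0 v)
          - f ((update (x ∘ Equiv.swap (0 : Fin (K + 1)) k.succ) 0 v) ∘ Equiv.swap (0 : Fin (K + 1)) k.succ)) ^ 2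
      = ∑ b : S, ∑ r' : Fin K → S, μ 0 (r' k) * R (update r' k b) * ∑ v, μ k.succ v * G v r' := by
    rw [sum_state_eq_sum_cons]
    have e : ∀ (a : S) (r : Fin K → S), (∑ v, tensorFun μ (Fin.cons a r) * μ k.succ v
        * (f (update ((Fin.cons a r : Fin (K + 1) → S) ∘ Equiv.swap (0 : Fin (K + 1)) k.succ) 0 v)
          - f ((update ((Fin.cons a r : Fin (K + 1) → S) ∘ Equiv.swap (0 : Fin (K + 1)) k.succ) 0 v)
            ∘ Equiv.swap (0 : Fin (K + 1)) k.succ)) ^ 2)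
        = μ 0 a * R r * ∑ v, μ k.succ v * G v (update r k a) := by
      intro a r
      rw [cons_comp_swap_zero_succ, tensorFun_cons_succProd, Finset.mul_sum]
      refine sum_congr rfl fun v _ => ?_
      rw [Fin.update_cons_zero]
      simp only [hG, hR]
      ring
    rw [sum_congr rfl fun a _ => sum_congr rfl fun r _ => e a r]
    rw [sum_pair_reindex k (fun a r => μ 0 a * R r * ∑ v, μ k.succ v * G v (update r k a))]
    simp only [update_idem, update_eq_self]
  have W : ∀ (b : S) (r' : Fin K → S), μ 0 (r' k) * R (update r' k b) ≤ 1 / r * (μ k.succ b * R r') := by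
    intro b r'
    have e := prod_succ_update_mul μ r' k b
    have key : μ 0 (r' k) ≤ 1 / r * μ k.succ (r' k) := by
      rw [one_div, inv_mul_eq_div, le_div_iff₀ hr, mul_comm]; exact hrc k (r' k)
    refine le_of_mul_le_mul_right ?_ (hμ k.succ (r' k))
    calc μ 0 (r' k) * R (update r' k b) * μ k.succ (r' k) = μ 0 (r' k) * (μ k.succ b * R r') := by
          rw [mul_assoc, hR]; simp only; rw [e]; ring
      _ ≤ 1 / r * μ k.succ (r' k) * (μ k.succ b * R r') :=
          mul_le_mul_of_nonneg_right key (mul_nonneg (hμ _ _).le (hR0 r'))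
      _ = 1 / r * (μ k.succ b * R r') * μ k.succ (r' k) := by ring
  have V : ∀ v, μ k.succ v ≤ 1 / r * μ 0 v := fun v => by
    rw [one_div, inv_mul_eq_div, le_div_iff₀ hr, mul_comm]; exact hrh k v
  have hin0 : ∀ r' : Fin K → S, 0 ≤ ∑ v, μ k.succ v * G v r' := fun r' => sum_nonneg fun v _ => mul_nonneg (hμ _ _).le (hG0 v r')
  rw [L1]
  calc ∑ b : S, ∑ r' : Fin K → S, μ 0 (r' k) * R (update r' k b) * ∑ v, μ k.succ v * G v r'
      ≤ ∑ b : S, ∑ r' : Fin K → S, 1 / r * (μ k.succ b * R r') * ∑ v, μ k.succ v * G v r' :=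
        sum_le_sum fun b _ => sum_le_sum fun r' _ => mul_le_mul_of_nonneg_right (W b r') (hin0 r')
    _ = 1 / r * ∑ r' : Fin K → S, R r' * ∑ v, μ k.succ v * G v r' := by
        rw [Finset.sum_comm, Finset.mul_sum]
        refine sum_congr rfl fun r' _ => ?_
        have e : ∀ b, 1 / r * (μ k.succ b * R r') * ∑ v, μ k.succ v * G v r'
            = μ k.succ b * (1 / r * (R r' * ∑ v, μ k.succ v * G v r')) := fun b => by ring
        simp_rw [e]
        rw [← Finset.sum_mul, hμ1, one_mul]
    _ ≤ 1 / r * ∑ r' : Fin K → S, R r' * ∑ v, 1 / r * μ 0 v * G v r' := by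
        refine mul_le_mul_of_nonneg_left (sum_le_sum fun r' _ => mul_le_mul_of_nonneg_left
          (sum_le_sum fun v _ => mul_le_mul_of_nonneg_right (V v) (hG0 v r')) (hR0 r')) (by positivity)
    _ = 1 / r ^ 2 * ∑ y : Fin (K + 1) → S, tensorFun μ y * (f y - f (y ∘ Equiv.swap (0 : Fin (K + 1)) k.succ)) ^ 2 := by
        rw [sum_state_eq_sum_cons (fun y => tensorFun μ y * (f y - f (y ∘ Equiv.swap (0 : Fin (K + 1)) k.succ)) ^ 2)]
        simp only [tensorFun_cons_succProd]
        rw [Finset.sum_comm, Finset.mul_sum, Finset.mul_sum]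
        refine sum_congr rfl fun r' _ => ?_
        rw [Finset.mul_sum, Finset.mul_sum, Finset.mul_sum]
        refine sum_congr rfl fun v _ => ?_
        simp only [hG, hR]
        ring

omit [DecidableEq S] hμ in
/-- **The hot coordinate's Efron–Stein term is a hot variance:**
`Σ_xΣ_v π̃(x)μ_0(v)(f x − f(x^{0←v}))² ≤ (1/γ₀)·U(f)`. [ours] -/
theorem star_hot_variance_le (hμ0 : ∀ k u, 0 ≤ μ k u) {M0 : Matrix S S ℝ} {γ₀ : ℝ} (hγ₀ : 0 < γ₀)
    (hgap0 : ∀ h : S → ℝ, γ₀ * lawVariance (μ 0) h ≤ dirichletForm (μ 0) M0 h) (f : (Fin (K + 1) → S) → ℝ) :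
    ∑ x : Fin (K + 1) → S, ∑ v, tensorFun μ x * μ 0 v * (f x - f (update x 0 v)) ^ 2
      ≤ 1 / γ₀ * ∑ y : Fin (K + 1) → S, ∑ v, tensorFun μ y * M0 (y 0) v * (f y - f (update y 0 v)) ^ 2 := by
  set R : (Fin K → S) → ℝ := fun r' => ∏ j : Fin K, μ j.succ (r' j) with hR
  set F : S → (Fin K → S) → ℝ := fun b r' => f (Fin.cons b r') with hF
  have hR0 : ∀ r', 0 ≤ R r' := fun r' => prod_nonneg fun j _ => hμ0 _ _
  have P : ∀ r' : Fin K → S, ∑ a, ∑ v, μ 0 a * μ 0 v * (F a r' - F v r') ^ 2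
      ≤ 1 / γ₀ * ∑ a, ∑ v, μ 0 a * M0 a v * (F a r' - F v r') ^ 2 := by
    intro r'
    have e1 : ∑ a, ∑ v, μ 0 a * μ 0 v * (F a r' - F v r') ^ 2 = 2 * lawVariance (μ 0) (fun a => F a r') := by
      rw [lawVariance_eq_half_sum (hμ1 0)]
      rw [← mul_assoc, show (2 : ℝ) * (1 / 2) = 1 by norm_num, one_mul]
      exact sum_congr rfl fun a _ => sum_congr rfl fun v _ => by ring
    have e2 : dirichletForm (μ 0) M0 (fun a => F a r') = (1 / 2) * ∑ a, ∑ v, μ 0 a * M0 a v * (F a r' - F v r') ^ 2 :=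
      rfl
    have h := hgap0 (fun a => F a r')
    rw [e2] at h
    rw [e1, one_div, inv_mul_eq_div, le_div_iff₀ hγ₀]
    linarith
  rw [sum_state_eq_sum_cons, sum_state_eq_sum_cons (fun y => ∑ v, tensorFun μ y * M0 (y 0) v * (f y - f (update y 0 v)) ^ 2)]
  simp only [tensorFun_cons_succProd, Fin.cons_zero, Fin.update_cons_zero]
  rw [Finset.sum_comm, Finset.sum_comm (f := fun a r' => ∑ v, μ 0 a * (∏ j : Fin K, μ j.succ (r' j)) * M0 a v
    * (f (Fin.cons a r') - f (Fin.cons v r')) ^ 2), Finset.mul_sum]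
  refine sum_le_sum fun r' _ => ?_
  have lhs : ∑ a, ∑ v, μ 0 a * R r' * μ 0 v * (f (Fin.cons a r') - f (Fin.cons v r')) ^ 2
      = R r' * ∑ a, ∑ v, μ 0 a * μ 0 v * (F a r' - F v r') ^ 2 := by
    rw [Finset.mul_sum]; refine sum_congr rfl fun a _ => ?_
    rw [Finset.mul_sum]; exact sum_congr rfl fun v _ => by simp only [hF]; ring
  have rhs : 1 / γ₀ * ∑ a, ∑ v, μ 0 a * R r' * M0 a v * (f (Fin.cons a r') - f (Fin.cons v r')) ^ 2
      = R r' * (1 / γ₀ * ∑ a, ∑ v, μ 0 a * M0 a v * (F a r' - F v r') ^ 2) := by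
    rw [Finset.mul_sum, Finset.mul_sum, Finset.mul_sum]; refine sum_congr rfl fun a _ => ?_
    rw [Finset.mul_sum, Finset.mul_sum, Finset.mul_sum]; exact sum_congr rfl fun v _ => by simp only [hF]; ring
  rw [lhs, rhs]
  exact mul_le_mul_of_nonneg_left (P r') (hR0 r')

end Legs


end Summit.Ventures.LatticeQCDFlow.Scaling

end
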